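import Summits.KontsevichZagierPeriods.KontsevichZagierPeriods.Theorems.SoloBlindBetaReflection
import Summits.KontsevichZagierPeriods.KontsevichZagierPeriods.Theorems.SoloBlindSector
import Summits.KontsevichZagierPeriods.KontsevichZagierPeriods.Theorems.SoloBlindTransfer
import Summits.KontsevichZagierPeriods.KontsevichZagierPeriods.Theorems.SoloBlindFermatCubic
import Literature.NumberTheory.Transcendental.KontsevichZagierGammaProofs
import Mathlib.RingTheory.AlgebraicIndependent.AlgebraicClosure
import HarnessLib

/-!
# The equianharmonic sector: a second unconditional rank-two sector

Generators `u = β(⅓,⅓)`, `v = β(⅔,⅔)` (classes of Euler's Beta representations in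
`Q = FormalRep / relations`). Inside the three rules (`equi_relation`):

  `u · v = (3/sin(π/3)) • x_π = 2√3 • x_π`,

from Dirichlet's relation `β(⅔,⅔)β(⅓,⅓) = β(⅓,⅔)β(⅓,1)` (`betaQ_dirichlet`), `β(⅓,1) = 3`
(`betaQ_first`) and the reflection formula inside the rules `β(⅓,⅔) = (1/sin(π/3)) • x_π`
(`SoloBlindBetaReflection.betaQ_reflection_third`). The periods `U = Γ(⅓)²/Γ(⅔)`,
`V = 3Γ(⅔)²/Γ(⅓)` of `u, v` satisfy `π² = (UV)²/12`, `Γ(⅓)³ = U²V/3`, so Chudnovsky's theorem (tree: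
`algebraicIndependent_real_pi_gamma_one_third`) transfers (`SoloBlindTransfer`) to the algebraic
independence of `U, V` (`algebraicIndependent_equi_pair`), and the sector principle
(`SoloBlindSector.kz_sector`) gives:

**Theorem E (`kz_equiSector`).** The Kontsevich–Zagier conjecture holds unconditionally on the
equianharmonic sector `M(u,v) = {z | [z] ∈ ℚ̄[u,v]} ⊋ M_π`: it contains the ℚ-rational Fermat cubic
regions `F_A`, `F_B` of `SoloBlindFermatCubic` (`[F_A] = u/6`, `[F_B] = v/6`), which are NOT in the
`π`-sector (`of_fermatA2_not_mem_piSector`), all of `M_π ⊇ B(π), Z(ζ(2))`, and all their products.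
Example (`kz_fermat_reflection`): `F_A × F_B` (dimension four, the product of the two areas,
`= √3π/18`) is KZ-equivalent to the one-dimensional rational representation
`[(0,∞), (1/4)/(1+v³)]`.

References: G. V. Chudnovsky, *Contributions to the theory of transcendental numbers* (1984),
Ch. 7 §2; M. Waldschmidt, *Elliptic functions and transcendence* (2008), Cor. 33;
M. Kontsevich, D. Zagier, *Periods* (2001), §1.2.
-/

noncomputable section

namespace Summit.KontsevichZagierPeriods.KontsevichZagierPeriods.Theorems

open Set MeasureTheory
open Literature.NumberTheory.Transcendental
open Literature.NumberTheory.Transcendental.KZ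

namespace SoloBlind

/-! ## The relation `u·v = 2√3·x_π` inside the rules -/

/-- `β(⅓,1) = 3` in `Q`. -/
theorem betaQ_third_one : betaQ (1 / 3) 1 = ((3:ℚ) : K₀) • (1 : Q) := by
  have h := betaQ_first (a := 1 / 3) (by norm_num)
  have h3 := congrArg (fun q : Q => ((3:ℚ) : K₀) • q) h
  simp only [smul_smul] at h3
  rwa [← Rat.cast_mul, show ((3:ℚ) * (1 / 3) : ℚ) = 1 by norm_num, Rat.cast_one, one_smul] at h3

/-- The coefficient `k = 3/sin(π/3) = 2√3` of the relation. -/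
def equiCoeff : K₀ := ((3:ℚ) : K₀) * reflCoeff 1 3

/-- `k = 2√3` as a real number. -/
theorem coe_equiCoeff : ((equiCoeff : K₀) : ℝ) = 2 * Real.sqrt 3 := by
  rw [equiCoeff, MulMemClass.coe_mul, coe_reflCoeff_one_three, coe_ratCast_K₀]
  push_cast
  rw [show (3:ℝ) * (2 / Real.sqrt 3) = 2 * (3 / Real.sqrt 3) by ring, Real.div_sqrt]

/-- `k ≠ 0`. -/
theorem equiCoeff_ne_zero : equiCoeff ≠ 0 := fun h => by
  have h' := congrArg (fun c : K₀ => (c : ℝ)) h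
  simp only [coe_equiCoeff, ZeroMemClass.coe_zero] at h'
  have : (0:ℝ) < 2 * Real.sqrt 3 := by positivity
  linarith

/-- **Theorem E, the relation: `β(⅓,⅓) · β(⅔,⅔) = (3/sin(π/3)) • x_π` in `Q`** — Dirichlet's
relation, `β(⅓,1) = 3` and the reflection formula at `⅓`, all inside the three rules. -/
theorem equi_relation : betaQ (1 / 3) (1 / 3) * betaQ (2 / 3) (2 / 3) = equiCoeff • xPi := by
  have hD := betaQ_dirichlet (a := 1 / 3) (b := 1 / 3) (c := 2 / 3) (by norm_num) (by norm_num)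
    (by norm_num)
  rw [show ((1:ℚ) / 3 + 1 / 3 : ℚ) = 2 / 3 by norm_num,
    show ((1:ℚ) / 3 + 2 / 3 : ℚ) = 1 by norm_num] at hD
  rw [mul_comm, hD, betaQ_reflection_third, betaQ_third_one, Algebra.smul_mul_assoc,
    Algebra.mul_smul_comm, mul_one, smul_smul, mul_comm (reflCoeff 1 3), equiCoeff]

/-- `x_π = k⁻¹ • (u·v)`. -/
theorem xPi_eq_smul_mul :
    xPi = equiCoeff⁻¹ • (betaQ (1 / 3) (1 / 3) * betaQ (2 / 3) (2 / 3)) := by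
  rw [equi_relation, smul_smul, inv_mul_cancel₀ equiCoeff_ne_zero, one_smul]

/-! ## The periods `U, V` and their algebraic independence -/

/-- `Γ(4/3) = Γ(⅓)/3`. -/
theorem Gamma_fourThirds : Real.Gamma (4 / 3) = 1 / 3 * Real.Gamma (1 / 3) := by
  rw [show (4:ℝ) / 3 = 1 / 3 + 1 by norm_num, Real.Gamma_add_one (by norm_num)]

/-- `U = evalQ u = Γ(⅓)²/Γ(⅔)`. -/
theorem evalQ_betaQ_third :
    evalQ (betaQ (1 / 3) (1 / 3)) = Real.Gamma (1 / 3) ^ 2 / Real.Gamma (2 / 3) := by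
  have h := evalQ_betaQ (a := 1 / 3) (b := 1 / 3) (by norm_num) (by norm_num)
  push_cast at h
  norm_num at h
  rw [h, sq]

/-- `V = evalQ v = Γ(⅔)²/Γ(4/3)`. -/
theorem evalQ_betaQ_twoThirds :
    evalQ (betaQ (2 / 3) (2 / 3)) = Real.Gamma (2 / 3) ^ 2 / Real.Gamma (4 / 3) := by
  have h := evalQ_betaQ (a := 2 / 3) (b := 2 / 3) (by norm_num) (by norm_num)
  push_cast at h
  norm_num at h
  rw [h, sq]

/-- **`U · V = 2√3 · π`** (the period of `equi_relation`). -/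
theorem evalQ_betaQ_third_mul_twoThirds :
    evalQ (betaQ (1 / 3) (1 / 3)) * evalQ (betaQ (2 / 3) (2 / 3)) = 2 * Real.sqrt 3 * Real.pi := by
  have h := congrArg evalQ equi_relation
  rwa [map_mul, evalQ_smul, evalQ_xPi, coe_equiCoeff] at h

/-- `π² = (UV)²/12`. -/
theorem pi_sq_eq :
    Real.pi ^ 2 = (evalQ (betaQ (1 / 3) (1 / 3)) * evalQ (betaQ (2 / 3) (2 / 3))) ^ 2 / 12 := by
  rw [evalQ_betaQ_third_mul_twoThirds, mul_pow, mul_pow, Real.sq_sqrt (by norm_num : (0:ℝ) ≤ 3)]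
  ring

/-- `Γ(⅓)³ = U²V/3`. -/
theorem Gamma_third_pow_three_eq :
    Real.Gamma (1 / 3) ^ 3 =
      evalQ (betaQ (1 / 3) (1 / 3)) ^ 2 * evalQ (betaQ (2 / 3) (2 / 3)) / 3 := by
  have hG : Real.Gamma (1 / 3) ≠ 0 := (Real.Gamma_pos_of_pos (by norm_num)).ne'
  have hH : Real.Gamma (2 / 3) ≠ 0 := (Real.Gamma_pos_of_pos (by norm_num)).ne'
  rw [evalQ_betaQ_third, evalQ_betaQ_twoThirds, Gamma_fourThirds]
  field_simp

/-- **`U` and `V` are algebraically independent over `ℚ`** (transfer of Chudnovsky's theorem on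
`π, Γ(⅓)` along `π² = (UV)²/12`, `Γ(⅓)³ = U²V/3`). -/
theorem algebraicIndependent_equi_pair :
    AlgebraicIndependent ℚ ![evalQ (betaQ (1 / 3) (1 / 3)), evalQ (betaQ (2 / 3) (2 / 3))] := by
  set U := evalQ (betaQ (1 / 3) (1 / 3)) with hU
  set V := evalQ (betaQ (2 / 3) (2 / 3)) with hV
  set K : IntermediateField ℚ ℝ := IntermediateField.adjoin ℚ ({U, V} : Set ℝ) with hK
  have hUK : U ∈ K := IntermediateField.subset_adjoin ℚ _ (by simp)
  have hVK : V ∈ K := IntermediateField.subset_adjoin ℚ _ (by simp)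
  have hnat : ∀ n : ℕ, (n : ℝ) ∈ K := fun n => natCast_mem K n
  have hπK : Real.pi ^ 2 ∈ K := by
    rw [pi_sq_eq, show (12 : ℝ) = (12 : ℕ) by norm_num]
    exact div_mem (pow_mem (mul_mem hUK hVK) 2) (hnat 12)
  have hGK : Real.Gamma (1 / 3) ^ 3 ∈ K := by
    rw [Gamma_third_pow_three_eq, show (3 : ℝ) = (3 : ℕ) by norm_num]
    exact div_mem (mul_mem (pow_mem hUK 2) hVK) (hnat 3)
  exact algebraicIndependent_pair_of_pow_mem_adjoin algebraicIndependent_real_pi_gamma_one_third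
    (by norm_num : 0 < 2) (by norm_num : 0 < 3) hπK hGK

/-- In particular `U = B(⅓,⅓)` is transcendental. -/
theorem transcendental_evalQ_betaQ_third : Transcendental ℚ (evalQ (betaQ (1 / 3) (1 / 3))) := by
  simpa using algebraicIndependent_equi_pair.transcendental 0

/-! ## The equianharmonic sector -/

/-- The two generating classes `u = β(⅓,⅓)`, `v = β(⅔,⅔)`. -/
def equiGen : Fin 2 → Q := ![betaQ (1 / 3) (1 / 3), betaQ (2 / 3) (2 / 3)]

/-- `equiGen 0 = u`. -/
@[simp] theorem equiGen_zero : equiGen 0 = betaQ (1 / 3) (1 / 3) := rfl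

/-- `equiGen 1 = v`. -/
@[simp] theorem equiGen_one : equiGen 1 = betaQ (2 / 3) (2 / 3) := rfl

/-- The periods of the generating classes are `U, V`. -/
theorem evalQ_equiGen : (fun i => evalQ (equiGen i)) =
    ![evalQ (betaQ (1 / 3) (1 / 3)), evalQ (betaQ (2 / 3) (2 / 3))] := by
  funext i
  fin_cases i <;> rfl

/-- The periods of the generating classes are algebraically independent over `ℚ̄ ∩ ℝ`. -/
theorem algebraicIndependent_evalQ_equiGen :
    AlgebraicIndependent K₀ fun i => evalQ (equiGen i) := by
  rw [evalQ_equiGen]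
  exact algebraicIndependent_equi_pair.algebraicClosure

/-- `u` and `v` are algebraically independent over `ℚ̄ ∩ ℝ` in `Q`. -/
theorem algebraicIndependent_equiGen : AlgebraicIndependent K₀ equiGen :=
  algebraicIndependent_of_evalQ algebraicIndependent_evalQ_equiGen

/-- **The equianharmonic sector** `M(u,v)`: all formal combinations of integral representations
whose class modulo the moves is a `ℚ̄`-polynomial in `β(⅓,⅓)` and `β(⅔,⅔)`. -/
def equiSector : NonUnitalSubring FormalRep := sector (range equiGen)

/-- Membership in the equianharmonic sector, unfolded. -/
theorem mem_equiSector {z : FormalRep} :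
    z ∈ equiSector ↔ mkQ z ∈ Algebra.adjoin K₀ (range equiGen) := Iff.rfl

/-- The Fermat cubic quadrant `F_A` lies in the equianharmonic sector (`[F_A] = u/6`). -/
theorem of_fermatA2_mem_equiSector : of fermatA2 ∈ equiSector := by
  rw [mem_equiSector, mkQ_fermatA2]
  exact Subalgebra.smul_mem _ (Algebra.subset_adjoin (mem_range_self (f := equiGen) 0)) _

/-- `F_B` lies in the equianharmonic sector (`[F_B] = v/6`). -/
theorem of_fermatB2_mem_equiSector : of fermatB2 ∈ equiSector := by
  rw [mem_equiSector, mkQ_fermatB2]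
  exact Subalgebra.smul_mem _ (Algebra.subset_adjoin (mem_range_self (f := equiGen) 1)) _

/-- `x_π = k⁻¹·u·v` lies in `ℚ̄[u,v]`. -/
theorem xPi_mem_adjoin_equiGen : xPi ∈ Algebra.adjoin K₀ (range equiGen) := by
  rw [xPi_eq_smul_mul]
  exact Subalgebra.smul_mem _ (mul_mem (Algebra.subset_adjoin (mem_range_self (f := equiGen) 0))
    (Algebra.subset_adjoin (mem_range_self (f := equiGen) 1))) _

/-- **`M_π ⊆ M(u,v)`**: the tame `π`-sector (hence `B(π)` and the `ζ(2)`-ring) lies in the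
equianharmonic sector. -/
theorem piSector_le_equiSector : piSector ≤ equiSector := fun _ hz =>
  Algebra.adjoin_le (singleton_subset_iff.mpr xPi_mem_adjoin_equiGen) hz

/-- `B(π) ⊆ M(u,v)`. -/
theorem lineRing_pi_le_equiSector : lineRing Real.pi ≤ equiSector :=
  lineRing_pi_le_piSector.trans piSector_le_equiSector

/-- **`β(⅓,⅓)` is not a `ℚ̄`-polynomial in `x_π`.** -/
theorem betaQ_third_not_mem_adjoin_xPi : betaQ (1 / 3) (1 / 3) ∉ Algebra.adjoin K₀ {xPi} := by
  intro h
  rw [Algebra.adjoin_singleton_eq_range_aeval, AlgHom.mem_range] at h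
  obtain ⟨p, hp⟩ := h
  set c : MvPolynomial (Fin 2) K₀ :=
    MvPolynomial.C equiCoeff⁻¹ * (MvPolynomial.X 0 * MvPolynomial.X 1) with hc
  have hcx : MvPolynomial.aeval equiGen c = xPi := by
    rw [hc, map_mul, map_mul, MvPolynomial.aeval_C, MvPolynomial.aeval_X, MvPolynomial.aeval_X,
      equiGen_zero, equiGen_one, ← Algebra.smul_def, ← xPi_eq_smul_mul]
  -- the polynomial `X₀ - p(c)` over `K₀` vanishes at `(u,v)`, hence is `0`
  have hPg : MvPolynomial.aeval equiGen (MvPolynomial.X 0 - Polynomial.aeval c p) = 0 := by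
    rw [map_sub, MvPolynomial.aeval_X, ← Polynomial.aeval_algHom_apply, hcx, hp, equiGen_zero,
      sub_self]
  have hP0 := (algebraicIndependent_iff.mp algebraicIndependent_equiGen) _ hPg
  -- evaluating at `(t, 0)`: `t = p(0)` for every `t`
  have hev : ∀ t : K₀, t - Polynomial.aeval (0 : K₀) p = 0 := fun t => by
    have h1 := congrArg (MvPolynomial.aeval (![t, 0] : Fin 2 → K₀)) hP0
    rw [map_sub, MvPolynomial.aeval_X, ← Polynomial.aeval_algHom_apply, hc, map_mul, map_mul,
      MvPolynomial.aeval_C, MvPolynomial.aeval_X, MvPolynomial.aeval_X, map_zero] at h1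
    simpa using h1
  exact one_ne_zero ((sub_eq_zero.mp (hev 1)).trans (sub_eq_zero.mp (hev 0)).symm)

/-- **`F_A ∉ M_π`: the equianharmonic sector is strictly bigger than the tame `π`-sector.** -/
theorem of_fermatA2_not_mem_piSector : of fermatA2 ∉ piSector := fun h => by
  have h' : ((6:ℚ) : K₀) • mkQ (of fermatA2) ∈ Algebra.adjoin K₀ {xPi} :=
    Subalgebra.smul_mem _ (mem_piSector.mp h) _
  rw [mkQ_fermatA2, smul_smul, ← Rat.cast_mul, show ((6:ℚ) * (1 / 6) : ℚ) = 1 by norm_num,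
    Rat.cast_one, one_smul] at h'
  exact betaQ_third_not_mem_adjoin_xPi h'

/-- **The equianharmonic-sector kernel theorem (unconditional).** An element of `M(u,v)` with
period `0` is a consequence of the three rules. -/
theorem equiSector_kernel {z : FormalRep} (hz : z ∈ equiSector) (h0 : eval z = 0) :
    z ∈ relations :=
  sector_kernel algebraicIndependent_evalQ_equiGen hz h0

/-- **Theorem E: the Kontsevich–Zagier conjecture on the equianharmonic sector (unconditional).**
Two integral representations in `M(u,v)` — e.g. any products of `F_A`, `F_B`, Beta
representations `β(a,b)` with `a, b ∈ ⅓ℤ` reachable by the identities, representations in `B(π)`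
and the `ζ(2)`-ring, in any dimensions — with the same period are equivalent under the rules. -/
theorem kz_equiSector {n m : ℕ} (r : IntegralRep n) (r' : IntegralRep m)
    (hr : of r ∈ equiSector) (hr' : of r' ∈ equiSector) (hv : r.value = r'.value) :
    Equivalent r r' :=
  kz_sector algebraicIndependent_evalQ_equiGen r r' hr hr' hv

/-! ## Consequences for the Fermat cubic regions -/

/-- **`[F_A]·[F_B] = (1/(6√3)) • x_π`** in `Q`. -/
theorem fermat_euler : mkQ (of fermatA2) * mkQ (of fermatB2) =
    ((((1:ℚ) / 36 : ℚ) : K₀) * equiCoeff) • xPi := by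
  rw [mkQ_fermatA2, mkQ_fermatB2, Algebra.smul_mul_assoc, Algebra.mul_smul_comm, smul_smul,
    equi_relation, smul_smul, ← Rat.cast_mul, show ((1:ℚ) / 6 * (1 / 6) : ℚ) = 1 / 36 by norm_num]

/-- **The product of the two areas: `|F_A| · |F_B| = √3·π/18`.** -/
theorem fermatA2_value_mul_fermatB2_value :
    fermatA2.value * fermatB2.value = Real.sqrt 3 * Real.pi / 18 := by
  have h := congrArg evalQ fermat_euler
  rw [map_mul, evalQ_mkQ, evalQ_mkQ, eval_of, eval_of, evalQ_smul, evalQ_xPi,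
    MulMemClass.coe_mul, coe_equiCoeff, coe_ratCast_K₀] at h
  rw [h]
  push_cast
  ring

/-- **Example.** `F_A × F_B` (four-dimensional, ℚ-rational) and the one-dimensional ℚ-rational
representation `(1/12)·R_{1,3} = [(0,∞), (1/4)/(1+v³)]` of `√3π/18` are KZ-equivalent: by
`fermat_euler` and the reflection representation `[R_{1,3}] = (1/sin(π/3)) • x_π`
(`mkQ_reflRep`), with no appeal to the sector theorem. -/
theorem kz_fermat_reflection :
    Equivalent (fermatA2.prod fermatB2)
      ((reflRep 1 3 one_pos (by norm_num)).constMul (((1:ℚ) / 12 : ℚ) : ℝ)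
        (isAlgebraic_rat ℚ _)) := by
  rw [Equivalent, ← mkQ_eq_mkQ_iff, ← of_mul_of, mkQ_mul, fermat_euler, mkQ_constMul_ratCast,
    mkQ_reflRep, smul_smul, equiCoeff, ← mul_assoc, ← Rat.cast_mul,
    show ((1:ℚ) / 36 * 3 : ℚ) = 1 / 12 by norm_num]

/-- **Example (sector theorem).** `F_A × F_B × Z` (`Z` = Kontsevich–Zagier's `ζ(2)`, total
dimension six) and `S × F_A × F_B` (`S` = the unit-square representation of `π²/6`) are
KZ-equivalent. -/
theorem kz_fermat_zetaTwo :
    Equivalent ((fermatA2.prod fermatB2).prod zetaTwoRep)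
      ((unitSquareRep.prod fermatA2).prod fermatB2) := by
  have hA := of_fermatA2_mem_equiSector
  have hB := of_fermatB2_mem_equiSector
  have hZ : of zetaTwoRep ∈ equiSector := piSector_le_equiSector of_zetaTwoRep_mem_piSector
  have hS : of unitSquareRep ∈ equiSector := piSector_le_equiSector of_unitSquareRep_mem_piSector
  refine kz_equiSector _ _ ?_ ?_ ?_
  · rw [← of_mul_of, ← of_mul_of]
    exact mul_mem (mul_mem hA hB) hZ
  · rw [← of_mul_of, ← of_mul_of]
    exact mul_mem (mul_mem hS hA) hB
  · rw [IntegralRep.value_prod, IntegralRep.value_prod, IntegralRep.value_prod,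
      IntegralRep.value_prod, unitSquareRep_value, zetaTwoRep_value]
    ring

end SoloBlind

end Summit.KontsevichZagierPeriods.KontsevichZagierPeriods.Theorems
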